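import Summits.Ventures.PercRepro.RankLevelSetPerElemTwo

/-! # RankLevelSetPerElemReduce — THE LEVEL-WISE REDUCTIONS OF THE PER-ELEMENT INEQUALITY (★★): A PARALLEL
PAIR, A COLOOP OR A LOOP ANYWHERE IN THE MATROID SENDS LEVEL `j + 1` TO A SMALLER MATROID; THE MIDDLE LEVEL IS AN
EQUALITY; HENCE (★★) AT LEVEL `3` FOR EVERY MATROID FOLLOWS FROM THE SIMPLE COLOOP-FREE CASE (night-1 g35;
dossier §47.8′; on `RankLevelSetPerElemTwo`)

(★★) at level `j` for the element `y` is `#{Z ∈ D_j : y ∉ Z} ≤ #{Q ∈ D_{j+1} : y ∈ Q}` (g24). REDUCTIONS.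
(1) A PARALLEL PAIR `{u, v}` with `N = M ／ {u} ＼ {v}` (g25's split bijections): for `y ∉ {u, v}` both sides at
level `j + 1` of `M` are twice the sides at level `j` of `N` (`perElem_succ_of_parallel_other`); for `y = u` they
are `D_j(N)` and `D_{j+1}(N)` (`perElem_succ_of_parallel_self`). (2) A COLOOP `x` with `M' = M ＼ {x}`: the
bi-independent sets of `M` are those of `M'` with or without `x` (`avoid_ncard_of_coloop`,
`through_ncard_of_coloop`), so level `j + 1` of `M` at `y ≠ x` follows from the levels `j` and `j + 1` of `M'`
(`perElem_succ_of_coloop`), and at the coloop itself (★★) is an equality (`perElem_coloop_self`). (3) A LOOP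
anywhere: no bi-independent set at all (`biIndep_eq_empty_of_isLoop`). (4) At the MIDDLE `#E = 2j + 1` (★★) at
level `j` is an equality by complementation (`perElem_middle_eq`). COROLLARY (**`perElemAt_three_of_simple`**):
if every simple coloop-free finite matroid on `8 ≤ #E` elements satisfies (★★) at level `3` at every element, then
EVERY finite matroid does — by strong induction on `#E` with the levels `≤ 2` of `RankLevelSetPerElemTwo`. Every
declaration has a docstring; imports: the cell's own modules and Mathlib only. Axioms: standard. -/

namespace PercRepro

open Set Matroid

variable {α : Type} (M : Matroid α) [M.Finite]

/-! ## A parallel pair anywhere -/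

/-- **Level `j + 1` of `M` at an element outside a parallel pair `{u, v}` follows from level `j` of
`N = M ／ {u} ＼ {v}`** (both sides double, g25's `ncard_notMem_eq_two_mul` / `ncard_mem_eq_two_mul`). -/
theorem perElem_succ_of_parallel_other {u v y : α} (h : ParallelPair M u v) (hyu : y ≠ u) (hyv : y ≠ v) (j : ℕ)
    (hN : {Z ∈ biIndep ((M.contract {u}).delete {v}) j | y ∉ Z}.ncard ≤
      {Q ∈ biIndep ((M.contract {u}).delete {v}) (j + 1) | y ∈ Q}.ncard) :
    {Z ∈ biIndep M (j + 1) | y ∉ Z}.ncard ≤ {Q ∈ biIndep M (j + 1 + 1) | y ∈ Q}.ncard := by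
  rw [ncard_notMem_eq_two_mul M h hyu hyv j, ncard_mem_eq_two_mul M h hyu hyv (j + 1)]
  exact Nat.mul_le_mul_left 2 hN

/-- **Level `j + 1` of `M` at the element `u` of a parallel pair `{u, v}` is `D_j(N) ≤ D_{j+1}(N)`**
(`avoid_ncard_of_parallel`, `through_ncard_of_parallel`). -/
theorem perElem_succ_of_parallel_self {u v : α} (h : ParallelPair M u v) (j : ℕ)
    (hN : biIndepCount ((M.contract {u}).delete {v}) j ≤ biIndepCount ((M.contract {u}).delete {v}) (j + 1)) :
    {Z ∈ biIndep M (j + 1) | u ∉ Z}.ncard ≤ {Q ∈ biIndep M (j + 1 + 1) | u ∈ Q}.ncard := by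
  rw [avoid_ncard_of_parallel M h j, through_ncard_of_parallel M h (j + 1)]
  exact hN

/-! ## A loop anywhere -/

omit [M.Finite] in
/-- A loop `ℓ` kills every bi-independent set: it can be neither in `Z` nor in `E ∖ Z`. -/
lemma biIndep_eq_empty_of_isLoop {ℓ : α} (hl : M.IsLoop ℓ) (j : ℕ) : biIndep M j = ∅ := by
  rw [Set.eq_empty_iff_forall_notMem]
  rintro Z ⟨-, -, hZi, hcind⟩
  by_cases hℓ : ℓ ∈ Z
  · exact hl.notMem_of_indep hZi hℓ
  · exact hl.notMem_of_indep hcind ⟨hl.mem_ground, hℓ⟩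

/-! ## A coloop anywhere -/

omit [M.Finite] in
/-- The bi-independent `j`-sets of `M` avoiding a coloop `x` are the bi-independent `j`-sets of `M ＼ {x}`. -/
lemma biIndep_filter_notMem_coloop {x : α} (hx : M.IsColoop x) (j : ℕ) :
    {Z ∈ biIndep M j | x ∉ Z} = biIndep (M.delete {x}) j := by
  ext Z
  simp only [Set.mem_setOf_eq]
  constructor
  · rintro ⟨⟨hZE, hZj, hZi, hcind⟩, hxZ⟩
    refine ⟨?_, hZj, ?_, ?_⟩
    · rw [Matroid.delete_ground]
      intro e he
      refine ⟨hZE he, fun h => hxZ ?_⟩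
      rw [Set.mem_singleton_iff] at h
      exact h ▸ he
    · rw [Matroid.delete_indep_iff]
      exact ⟨hZi, Set.disjoint_singleton_right.mpr hxZ⟩
    · rw [Matroid.delete_indep_iff, Matroid.delete_ground]
      refine ⟨hcind.subset (fun e he => ⟨he.1.1, he.2⟩), ?_⟩
      rw [Set.disjoint_singleton_right]
      exact fun h => h.1.2 (Set.mem_singleton x)
  · rintro ⟨hZE, hZj, hZi, hcind⟩
    rw [Matroid.delete_ground] at hZE hcind
    rw [Matroid.delete_indep_iff] at hZi hcind
    have hxZ : x ∉ Z := fun h => (hZE h).2 (Set.mem_singleton x)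
    refine ⟨⟨fun e he => (hZE he).1, hZj, hZi.1, ?_⟩, hxZ⟩
    have heq : M.E \ Z = insert x ((M.E \ {x}) \ Z) := by
      ext e
      simp only [Set.mem_sdiff, Set.mem_insert_iff, Set.mem_singleton_iff]
      constructor
      · rintro ⟨heE, heZ⟩
        by_cases hex : e = x
        · exact Or.inl hex
        · exact Or.inr ⟨⟨heE, hex⟩, heZ⟩
      · rintro (rfl | ⟨⟨heE, -⟩, heZ⟩)
        · exact ⟨hx.mem_ground, hxZ⟩
        · exact ⟨heE, heZ⟩
    rw [heq]
    exact hx.insert_indep_of_indep hcind.1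

/-- The bi-independent `(j+1)`-sets of `M` through a coloop `x` are, minus `x`, the bi-independent `j`-sets of
`M ＼ {x}` (with any property `P` of the set carried along as `P (insert x ·)`). -/
lemma ncard_biIndep_mem_coloop_eq {x : α} (hx : M.IsColoop x) (j : ℕ) (P : Set α → Prop) :
    {Z ∈ biIndep M (j + 1) | x ∈ Z ∧ P Z}.ncard = {T ∈ biIndep (M.delete {x}) j | P (insert x T)}.ncard := by
  refine Set.ncard_congr (fun Z _ => Z \ {x}) ?_ ?_ ?_
  · rintro Z ⟨⟨hZE, hZj, hZi, hcind⟩, hxZ, hP⟩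
    have hfin : Z.Finite := Set.finite_of_ncard_pos (by omega)
    refine ⟨⟨?_, ?_, ?_, ?_⟩, ?_⟩
    · rw [Matroid.delete_ground]
      exact fun e he => ⟨hZE he.1, he.2⟩
    · rw [Set.ncard_sdiff_singleton_of_mem hxZ, hZj]
      rfl
    · rw [Matroid.delete_indep_iff]
      exact ⟨hZi.subset Set.sdiff_subset, Set.disjoint_sdiff_left⟩
    · rw [Matroid.delete_indep_iff, Matroid.delete_ground]
      refine ⟨hcind.subset (fun e he => ⟨he.1.1, fun h => he.2 ⟨h, he.1.2⟩⟩), ?_⟩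
      rw [Set.disjoint_singleton_right]
      exact fun h => h.1.2 (Set.mem_singleton x)
    · rwa [Set.insert_sdiff_singleton, Set.insert_eq_of_mem hxZ]
  · rintro Z₁ Z₂ ⟨-, hx₁, -⟩ ⟨-, hx₂, -⟩ heq
    have : insert x (Z₁ \ {x}) = insert x (Z₂ \ {x}) := by rw [heq]
    rwa [Set.insert_sdiff_singleton, Set.insert_sdiff_singleton, Set.insert_eq_of_mem hx₁,
      Set.insert_eq_of_mem hx₂] at this
  · rintro T ⟨⟨hTE, hTj, hTi, hcind⟩, hP⟩
    rw [Matroid.delete_ground] at hTE hcind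
    rw [Matroid.delete_indep_iff] at hTi hcind
    have hxT : x ∉ T := fun h => (hTE h).2 (Set.mem_singleton x)
    have hfin : T.Finite := (M.ground_finite.subset (fun e he => (hTE he).1))
    refine ⟨insert x T, ⟨⟨Set.insert_subset hx.mem_ground (fun e he => (hTE he).1), ?_,
      hx.insert_indep_of_indep hTi.1, ?_⟩, Set.mem_insert x T, hP⟩, ?_⟩
    · rw [Set.ncard_insert_of_notMem hxT hfin, hTj]
    · have heq : M.E \ insert x T = (M.E \ {x}) \ T := by
        ext e
        simp only [Set.mem_sdiff, Set.mem_insert_iff, Set.mem_singleton_iff, not_or]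
        tauto
      rw [heq]
      exact hcind.1
    · rw [Set.insert_sdiff_of_mem _ (Set.mem_singleton x), Set.sdiff_singleton_eq_self hxT]

omit [M.Finite] in
/-- `M ＼ {x}` is finite when `M` is. -/
lemma delete_finite' [hM : M.Finite] (x : α) : (M.delete {x}).Finite :=
  ⟨hM.ground_finite.subset (by rw [Matroid.delete_ground]; exact Set.sdiff_subset)⟩

/-- **The avoid-`y` count at level `j + 1` across a coloop `x ≠ y`**:
`#{Z ∈ D_{j+1}(M) : y ∉ Z} = #{T ∈ D_j(M') : y ∉ T} + #{Z ∈ D_{j+1}(M') : y ∉ Z}` with `M' = M ＼ {x}`. -/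
lemma avoid_ncard_of_coloop {x y : α} (hx : M.IsColoop x) (hyx : y ≠ x) (j : ℕ) :
    {Z ∈ biIndep M (j + 1) | y ∉ Z}.ncard =
      {T ∈ biIndep (M.delete {x}) j | y ∉ T}.ncard + {Z ∈ biIndep (M.delete {x}) (j + 1) | y ∉ Z}.ncard := by
  have hfin : {Z ∈ biIndep M (j + 1) | y ∉ Z}.Finite := (biIndep_finite M (j + 1)).subset (fun Z hZ => hZ.1)
  have hsplit : {Z ∈ biIndep M (j + 1) | y ∉ Z} =
      {Z ∈ biIndep M (j + 1) | x ∈ Z ∧ y ∉ Z} ∪ {Z ∈ biIndep (M.delete {x}) (j + 1) | y ∉ Z} := by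
    rw [← biIndep_filter_notMem_coloop M hx (j + 1)]
    ext Z
    simp only [Set.mem_setOf_eq, Set.mem_union]
    constructor
    · rintro ⟨hZ, hyZ⟩
      by_cases hxZ : x ∈ Z
      · exact Or.inl ⟨hZ, hxZ, hyZ⟩
      · exact Or.inr ⟨⟨hZ, hxZ⟩, hyZ⟩
    · rintro (⟨hZ, -, hyZ⟩ | ⟨⟨hZ, -⟩, hyZ⟩) <;> exact ⟨hZ, hyZ⟩
  have hdisj : Disjoint {Z ∈ biIndep M (j + 1) | x ∈ Z ∧ y ∉ Z}
      {Z ∈ biIndep (M.delete {x}) (j + 1) | y ∉ Z} := by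
    rw [Set.disjoint_left]
    rintro Z ⟨-, hxZ, -⟩ ⟨hZ, -⟩
    rw [← biIndep_filter_notMem_coloop M hx (j + 1)] at hZ
    exact hZ.2 hxZ
  rw [hsplit, Set.ncard_union_eq hdisj (hfin.subset (by rw [hsplit]; exact Set.subset_union_left))
    (hfin.subset (by rw [hsplit]; exact Set.subset_union_right)),
    ncard_biIndep_mem_coloop_eq M hx j (fun Z => y ∉ Z)]
  congr 2
  ext T
  simp only [Set.mem_setOf_eq, Set.mem_insert_iff, not_or, and_congr_right_iff]
  exact fun _ => ⟨fun h => h.2, fun h => ⟨hyx, h⟩⟩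

/-- **The through-`y` count at level `j + 1` across a coloop `x ≠ y`**:
`#{Q ∈ D_{j+1}(M) : y ∈ Q} = #{T ∈ D_j(M') : y ∈ T} + #{Q ∈ D_{j+1}(M') : y ∈ Q}` with `M' = M ＼ {x}`. -/
lemma through_ncard_of_coloop {x y : α} (hx : M.IsColoop x) (hyx : y ≠ x) (j : ℕ) :
    {Q ∈ biIndep M (j + 1) | y ∈ Q}.ncard =
      {T ∈ biIndep (M.delete {x}) j | y ∈ T}.ncard + {Q ∈ biIndep (M.delete {x}) (j + 1) | y ∈ Q}.ncard := by
  have hfin : {Q ∈ biIndep M (j + 1) | y ∈ Q}.Finite := (biIndep_finite M (j + 1)).subset (fun Q hQ => hQ.1)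
  have hsplit : {Q ∈ biIndep M (j + 1) | y ∈ Q} =
      {Q ∈ biIndep M (j + 1) | x ∈ Q ∧ y ∈ Q} ∪ {Q ∈ biIndep (M.delete {x}) (j + 1) | y ∈ Q} := by
    rw [← biIndep_filter_notMem_coloop M hx (j + 1)]
    ext Q
    simp only [Set.mem_setOf_eq, Set.mem_union]
    constructor
    · rintro ⟨hQ, hyQ⟩
      by_cases hxQ : x ∈ Q
      · exact Or.inl ⟨hQ, hxQ, hyQ⟩
      · exact Or.inr ⟨⟨hQ, hxQ⟩, hyQ⟩
    · rintro (⟨hQ, -, hyQ⟩ | ⟨⟨hQ, -⟩, hyQ⟩) <;> exact ⟨hQ, hyQ⟩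
  have hdisj : Disjoint {Q ∈ biIndep M (j + 1) | x ∈ Q ∧ y ∈ Q}
      {Q ∈ biIndep (M.delete {x}) (j + 1) | y ∈ Q} := by
    rw [Set.disjoint_left]
    rintro Q ⟨-, hxQ, -⟩ ⟨hQ, -⟩
    rw [← biIndep_filter_notMem_coloop M hx (j + 1)] at hQ
    exact hQ.2 hxQ
  rw [hsplit, Set.ncard_union_eq hdisj (hfin.subset (by rw [hsplit]; exact Set.subset_union_left))
    (hfin.subset (by rw [hsplit]; exact Set.subset_union_right)),
    ncard_biIndep_mem_coloop_eq M hx j (fun Q => y ∈ Q)]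
  congr 2
  ext T
  simp only [Set.mem_setOf_eq, Set.mem_insert_iff, and_congr_right_iff]
  exact fun _ => ⟨fun h => h.resolve_left hyx, fun h => Or.inr h⟩

/-- **Level `j + 1` of `M` at `y ≠ x` across a coloop `x` follows from the levels `j` and `j + 1` of
`M' = M ＼ {x}`.** -/
theorem perElem_succ_of_coloop {x y : α} (hx : M.IsColoop x) (hyx : y ≠ x) (j : ℕ)
    (h₁ : {Z ∈ biIndep (M.delete {x}) j | y ∉ Z}.ncard ≤ {Q ∈ biIndep (M.delete {x}) (j + 1) | y ∈ Q}.ncard)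
    (h₂ : {Z ∈ biIndep (M.delete {x}) (j + 1) | y ∉ Z}.ncard ≤
      {Q ∈ biIndep (M.delete {x}) (j + 1 + 1) | y ∈ Q}.ncard) :
    {Z ∈ biIndep M (j + 1) | y ∉ Z}.ncard ≤ {Q ∈ biIndep M (j + 1 + 1) | y ∈ Q}.ncard := by
  rw [avoid_ncard_of_coloop M hx hyx j, through_ncard_of_coloop M hx hyx (j + 1)]
  exact Nat.add_le_add h₁ h₂

/-- **At a coloop `x` itself (★★) is an equality at every level `j`**: the bi-independent `j`-sets avoiding `x` and
the `(j+1)`-sets through `x` are both the bi-independent `j`-sets of `M ＼ {x}`. -/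
theorem perElem_coloop_self {x : α} (hx : M.IsColoop x) (j : ℕ) :
    {Z ∈ biIndep M j | x ∉ Z}.ncard = {Q ∈ biIndep M (j + 1) | x ∈ Q}.ncard := by
  rw [biIndep_filter_notMem_coloop M hx j]
  have e1 : {Q | Q ∈ biIndep M (j + 1) ∧ x ∈ Q} = {Q ∈ biIndep M (j + 1) | x ∈ Q ∧ True} := by
    ext Q; simp only [Set.mem_setOf_eq, and_true]
  rw [e1, ncard_biIndep_mem_coloop_eq M hx j (fun _ => True)]
  congr 1
  ext T; simp only [Set.mem_setOf_eq, and_true]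

/-! ## The middle level is an equality -/

/-- **At the middle `#E = 2j + 1`, (★★) at level `j` is an equality**: `Z ↦ E ∖ Z` is a bijection from the
bi-independent `j`-sets avoiding `y` onto the bi-independent `(j+1)`-sets through `y`. -/
theorem perElem_middle_eq {y : α} (hy : y ∈ M.E) (j : ℕ) (hn : M.E.ncard = 2 * j + 1) :
    {Z ∈ biIndep M j | y ∉ Z}.ncard = {Q ∈ biIndep M (j + 1) | y ∈ Q}.ncard := by
  refine Set.ncard_congr (fun Z _ => M.E \ Z) ?_ ?_ ?_
  · rintro Z ⟨⟨hZE, hZj, hZi, hcind⟩, hyZ⟩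
    refine ⟨⟨Set.sdiff_subset, ?_, hcind, ?_⟩, ⟨hy, hyZ⟩⟩
    · rw [Set.ncard_sdiff hZE (M.ground_finite.subset hZE), hZj, hn]
      omega
    · rwa [Set.sdiff_sdiff_right_self, Set.inter_eq_right.mpr hZE]
  · rintro Z₁ Z₂ ⟨⟨hZ₁E, -, -, -⟩, -⟩ ⟨⟨hZ₂E, -, -, -⟩, -⟩ heq
    have : M.E \ (M.E \ Z₁) = M.E \ (M.E \ Z₂) := by rw [heq]
    rwa [Set.sdiff_sdiff_right_self, Set.sdiff_sdiff_right_self, Set.inter_eq_right.mpr hZ₁E,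
      Set.inter_eq_right.mpr hZ₂E] at this
  · rintro Q ⟨⟨hQE, hQj, hQi, hcind⟩, hyQ⟩
    refine ⟨M.E \ Q, ⟨⟨Set.sdiff_subset, ?_, hcind, ?_⟩, fun h => h.2 hyQ⟩, ?_⟩
    · rw [Set.ncard_sdiff hQE (M.ground_finite.subset hQE), hQj, hn]
      omega
    · rwa [Set.sdiff_sdiff_right_self, Set.inter_eq_right.mpr hQE]
    · rw [Set.sdiff_sdiff_right_self, Set.inter_eq_right.mpr hQE]

/-! ## (★★) at level `3` reduces to the simple coloop-free case -/

/-- **(★★) AT LEVEL `3` FOR EVERY FINITE MATROID ON `n` ELEMENTS FOLLOWS FROM THE SIMPLE COLOOP-FREE CASE** (the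
auxiliary form, by strong induction on `n`): a loop kills every bi-independent set; a parallel pair `{u, v}`
sends the level to level `2` of `M ／ {u} ＼ {v}` (`perElemAt_two`) or to `D_2 ≤ D_3` of the minor
(`mono_step_two`); a coloop `x ≠ y` sends it to the levels `2` (`perElemAt_two`) and `3` (induction, or the
middle equality on `7` elements) of `M ＼ {x}`, and at the coloop itself (★★) is an equality. -/
theorem perElemAt_three_of_simple_aux
    (H : ∀ (M' : Matroid α) [M'.Finite], (∀ e, ¬ M'.IsLoop e) → (∀ u v, ¬ ParallelPair M' u v) →
      (∀ e, ¬ M'.IsColoop e) → ∀ y ∈ M'.E, 8 ≤ M'.E.ncard →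
        {Z ∈ biIndep M' 3 | y ∉ Z}.ncard ≤ {Q ∈ biIndep M' 4 | y ∈ Q}.ncard) :
    ∀ n : ℕ, ∀ (M' : Matroid α) [M'.Finite], M'.E.ncard = n → ∀ y ∈ M'.E, 8 ≤ n →
      {Z ∈ biIndep M' 3 | y ∉ Z}.ncard ≤ {Q ∈ biIndep M' 4 | y ∈ Q}.ncard := by
  intro n
  induction n using Nat.strong_induction_on with
  | _ n ih =>
    intro M' _ hn y hy h8
    -- a loop anywhere
    by_cases hloop : ∃ ℓ, M'.IsLoop ℓ
    · obtain ⟨ℓ, hℓ⟩ := hloop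
      have : {Z ∈ biIndep M' 3 | y ∉ Z} = ∅ := by
        rw [biIndep_eq_empty_of_isLoop M' hℓ 3]
        ext Z; simp
      rw [this, Set.ncard_empty]
      exact Nat.zero_le _
    simp only [not_exists] at hloop
    -- a parallel pair anywhere
    by_cases hpar : ∃ u v, ParallelPair M' u v
    · obtain ⟨u, v, huv⟩ := hpar
      haveI := contract_delete_finite M' u v
      have hcard := ncard_ground_contract_delete M' huv
      have hD : ∀ {u v : α} (h : ParallelPair M' u v),
          biIndepCount ((M'.contract {u}).delete {v}) 2 ≤ biIndepCount ((M'.contract {u}).delete {v}) 3 := by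
        intro u v h
        haveI := contract_delete_finite M' u v
        have hc := ncard_ground_contract_delete M' h
        have hstep := mono_step_two ((M'.contract {u}).delete {v}) (by rw [hc]; omega)
        rw [hc] at hstep
        have h4 : 4 * biIndepCount ((M'.contract {u}).delete {v}) 2 ≤
            (M'.E.ncard - 2 - 2) * biIndepCount ((M'.contract {u}).delete {v}) 2 :=
          Nat.mul_le_mul_right _ (by omega)
        omega
      by_cases hyu : y = u
      · subst hyu
        exact perElem_succ_of_parallel_self M' huv 2 (hD huv)
      by_cases hyv : y = v
      · subst hyv
        exact perElem_succ_of_parallel_self M' huv.symm 2 (hD huv.symm)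
      · have hyN : y ∈ ((M'.contract {u}).delete {v}).E := by
          rw [ground_contract_delete]
          exact ⟨hy, by simp only [Set.mem_insert_iff, Set.mem_singleton_iff, not_or]; exact ⟨hyu, hyv⟩⟩
        exact perElem_succ_of_parallel_other M' huv hyu hyv 2
          (perElemAt_two ((M'.contract {u}).delete {v}) hyN (by rw [hcard]; omega))
    simp only [not_exists] at hpar
    -- a coloop anywhere
    by_cases hcol : ∃ x, M'.IsColoop x
    · obtain ⟨x, hx⟩ := hcol
      haveI := delete_finite' M' x
      have hcard : (M'.delete {x}).E.ncard = n - 1 := by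
        rw [Matroid.delete_ground, Set.ncard_sdiff_singleton_of_mem hx.mem_ground, hn]
      by_cases hyx : y = x
      · subst hyx
        exact (perElem_coloop_self M' hx 3).le
      · have hyM : y ∈ (M'.delete {x}).E := by
          rw [Matroid.delete_ground]
          exact ⟨hy, by simpa using hyx⟩
        refine perElem_succ_of_coloop M' hx hyx 2 (perElemAt_two (M'.delete {x}) hyM (by omega)) ?_
        rcases Nat.lt_or_ge (n - 1) 8 with h7 | h8'
        · exact (perElem_middle_eq (M'.delete {x}) hyM 3 (by omega)).le
        · exact ih (n - 1) (by omega) (M'.delete {x}) hcard y hyM h8'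
    simp only [not_exists] at hcol
    exact H M' hloop hpar hcol y hy (by omega)

/-- **(★★) AT LEVEL `3` FOR EVERY FINITE MATROID FOLLOWS FROM THE SIMPLE COLOOP-FREE CASE**: if every finite
matroid without loops, parallel pairs and coloops on `≥ 8` elements satisfies (★★) at level `3` at every element,
then every finite matroid on `≥ 8` elements does (and then, summed over the elements, Mono's step `j = 3`). -/
theorem perElemAt_three_of_simple
    (H : ∀ (M' : Matroid α) [M'.Finite], (∀ e, ¬ M'.IsLoop e) → (∀ u v, ¬ ParallelPair M' u v) →
      (∀ e, ¬ M'.IsColoop e) → ∀ y ∈ M'.E, 8 ≤ M'.E.ncard →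
        {Z ∈ biIndep M' 3 | y ∉ Z}.ncard ≤ {Q ∈ biIndep M' 4 | y ∈ Q}.ncard)
    {y : α} (hy : y ∈ M.E) (hn : 8 ≤ M.E.ncard) :
    {Z ∈ biIndep M 3 | y ∉ Z}.ncard ≤ {Q ∈ biIndep M 4 | y ∈ Q}.ncard :=
  perElemAt_three_of_simple_aux H M.E.ncard M rfl y hy hn

end PercRepro
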